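import Literature.AnabelianGeometry.AbsoluteAnabelian.AbsTopIChains
import Mathlib.Topology.Algebra.Group.Quotient
import HarnessLib

/-!
# [AbsTopI] Remark 4.2.2 (group side): every term of a `Π`-chain again carries data of the kind
# Definition 4.2 starts with — `Gⱼ` slim, `[G : Gⱼ] < ∞`, `1 → Δⱼ → Πⱼ → Gⱼ → 1` exact (proof-only)

S. Mochizuki, *Topics in Absolute Anabelian Geometry I: Generalities* (2012) [AbsTopI] §4, Remark
4.2.2, p. 51 (manuscript pagination, lit key `paper:url-11ac98ba15fc`): "Note that in the situation of
Definition 4.2, (i), `Gⱼ` is a slim profinite group; `1 → Δⱼ → Πⱼ → Gⱼ → 1` is an extension of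
GSAFG-type that admits base-prime partial construction data `(kⱼ, Xⱼ, Σ)` … That is to say, we obtain,
for each `j`, similar data to the data introduced at the beginning of Definition 4.2."  Together with
Def 4.2 (i) (1_X) p. 47: "`kⱼ ⊆ k̃` is a finite extension of `k`".

The GROUP-THEORETIC part of these sentences, for a term `Πⱼ` of a `Π`-chain (abc-iut-L4-t4's
`ChainGroup`, `AbsTopIChains.lean`) over an extension `1 → Δ → Π → G → 1` with `G` slim (the
standing hypothesis of Def 4.2, p. 47 l. 8):

* `ChainGroup.isSlimGroup_rangeProj` — "`Gⱼ` is a slim profinite group": `Gⱼ = proj(Πⱼ) ⊆ G` is an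
  OPEN subgroup (1_Π) of the slim group `G`, and open subgroups of slim groups are slim
  (`IsSlimGroup.subgroup_of_isOpen`; the tree's `IsSlimGroup.of_injective_isOpenMap`, abc-iut
  `InitialThetaDataLocalSlim.lean`, is the same fact for an open embedding);
* `ChainGroup.finiteIndex_rangeProj` — "`kⱼ` … a finite extension of `k`", group side
  `[G : Gⱼ] < ∞` (an open subgroup of a compact group has finite index); likewise the domain of the
  rigidifying homomorphism and its image have finite index in `Π`, `Πⱼ`
  (`finiteIndex_dom`, `finiteIndex_range_rig`: `ρⱼ` is defined on, and hits, "finite étale" levels);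
* `ChainGroup.isClosed_geomJ`, `normal_geomJ`, `rangeRestrict_proj_surjective`,
  `ker_rangeRestrict_proj`, `nonempty_quotient_geomJ_mulEquiv_rangeProj` — "`1 → Δⱼ → Πⱼ → Gⱼ → 1`
  is an extension [of profinite groups]": `Δⱼ = Ker(Πⱼ → G)` is a closed normal subgroup,
  `Πⱼ ↠ Gⱼ` is surjective with kernel `Δⱼ`, `Πⱼ/Δⱼ ≅ Gⱼ`; assembled in `remark_4_2_2_groupSide`.

The scheme-theoretic clauses of Rmk 4.2.2 ("admits base-prime partial construction data", "`Xⱼ` is a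
hyperbolic orbicurve", the envelope `αⱼ`) concern the `X̃/X`-side of Def 4.2 (i)–(ii), which is not
typed (FOUNDATIONS row 12), and are not addressed.  Proof-only (no `def`); nothing here bears on
[IUTchIII] Cor 3.12; no side is taken.
-/

noncomputable section

open Topology
open scoped Pointwise

universe u

/-! ### Open subgroups of slim groups are slim -/

/-- An OPEN subgroup `K` of a slim topological group `G` is slim: an open subgroup `H ⊆ K` is open in
`G`, so an element of `K` centralising `H` centralises an open subgroup of `G` and is trivial
([FrdI] §0 p. 13 "slim"; [AbsTopI] Rmk 4.2.2 "`Gⱼ` is a slim profinite group").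
[cite: MochizukiAbsTopI2012, Rmk 4.2.2 p.51] -/
theorem Literature.AlgebraicGeometry.Frobenioids.IsSlimGroup.subgroup_of_isOpen
    {G : Type u} [Group G] [TopologicalSpace G]
    (hG : Literature.AlgebraicGeometry.Frobenioids.IsSlimGroup G) (K : Subgroup G)
    (hK : IsOpen (K : Set G)) : Literature.AlgebraicGeometry.Frobenioids.IsSlimGroup K := by
  refine ⟨fun H hH => ?_⟩
  -- the image of `H` in `G` is open
  have hH' : IsOpen ((H.map K.subtype : Subgroup G) : Set G) := by
    rw [Subgroup.coe_map]
    exact hK.isOpenMap_subtype_val _ hH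
  have hc := hG.centralizer_eq_bot _ hH'
  rw [eq_bot_iff]
  intro x hx
  rw [Subgroup.mem_bot]
  have hxG : (x : G) ∈ Subgroup.centralizer ((H.map K.subtype : Subgroup G) : Set G) := by
    rw [Subgroup.mem_centralizer_iff]
    intro g hg
    rw [SetLike.mem_coe] at hg
    obtain ⟨y, hy, rfl⟩ := Subgroup.mem_map.1 hg
    have hxy := Subgroup.mem_centralizer_iff.1 hx y hy
    simpa using congrArg Subtype.val hxy
  rw [hc, Subgroup.mem_bot] at hxG
  exact Subtype.ext hxG

namespace Literature.AnabelianGeometry.AbsoluteAnabelian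

open Literature.AlgebraicGeometry.Frobenioids (IsSlimGroup)

/-- An open subgroup of a compact topological group has finite index (the quotient is compact and
discrete).  Local copy of a classical fact (the tree has it in several `SemiGraphs` files, e.g.
`ArithOpenness.finiteIndex_of_isOpen_of_compactSpace`; not imported to keep the [AbsTopI] §4 files
independent of [SemiAnbd]). [cite: MochizukiAbsTopI2012, Def 4.2 (i) p.47] -/
private theorem finiteIndex_of_isOpen_of_compact {G : Type u} [Group G] [TopologicalSpace G]
    [IsTopologicalGroup G] [CompactSpace G] (H : Subgroup G) (hH : IsOpen (H : Set G)) :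
    H.FiniteIndex := by
  haveI : DiscreteTopology (G ⧸ H) := QuotientGroup.discreteTopology hH
  haveI : Finite (G ⧸ H) := finite_of_compact_of_discrete
  exact Subgroup.finiteIndex_of_finite_quotient

namespace FundamentalExtension

namespace ChainGroup

variable {E : FundamentalExtension.{u}}

/-! ### "`Gⱼ` is a slim profinite group" -/

/-- **[AbsTopI] Rmk 4.2.2, "`Gⱼ` is a slim profinite group"**: for `G` slim, the image
`Gⱼ = proj(Πⱼ) ⊆ G` of a chain term — an open subgroup by (1_Π) — is slim.
[cite: MochizukiAbsTopI2012, Rmk 4.2.2 p.51] -/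
theorem isSlimGroup_rangeProj (hG : IsSlimGroup E.gal) (L : E.ChainGroup) :
    IsSlimGroup L.proj.toMonoidHom.range :=
  hG.subgroup_of_isOpen _ (by rw [MonoidHom.coe_range]; exact L.isOpen_range_proj)

/-- `Gⱼ` is compact (a closed — since open — subgroup of the profinite `G`), hence profinite with the
subspace topology. [cite: MochizukiAbsTopI2012, Rmk 4.2.2 p.51] -/
theorem isClosed_rangeProj (L : E.ChainGroup) :
    IsClosed ((L.proj.toMonoidHom.range : Subgroup E.gal) : Set E.gal) :=
  Subgroup.isClosed_of_isOpen _ (by rw [MonoidHom.coe_range]; exact L.isOpen_range_proj)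

/-! ### "`kⱼ ⊆ k̃` is a finite extension of `k`": finite indices -/

/-- **[AbsTopI] Def 4.2 (i) (1_X) / Rmk 4.2.2, group side**: `[G : Gⱼ] < ∞` — the open subgroup
`Gⱼ ⊆ G` of the compact group `G` has finite index ("`kⱼ ⊆ k̃` is a finite extension of `k`").
[cite: MochizukiAbsTopI2012, Def 4.2 (i) p.47] -/
theorem finiteIndex_rangeProj (L : E.ChainGroup) : (L.proj.toMonoidHom.range).FiniteIndex :=
  finiteIndex_of_isOpen_of_compact _ (by rw [MonoidHom.coe_range]; exact L.isOpen_range_proj)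

/-- The domain `Π̃`-level of the rigidifying homomorphism `ρⱼ` is an open subgroup of `Π` of FINITE
INDEX (a "finite étale" level of the projective system `Π̃`). [cite: MochizukiAbsTopI2012, Def 4.2 (iii) p.49] -/
theorem finiteIndex_dom (L : E.ChainGroup) : L.dom.FiniteIndex :=
  finiteIndex_of_isOpen_of_compact _ L.isOpen_dom

/-- The image of the rigidifying homomorphism `ρⱼ` is an open subgroup of `Πⱼ` of FINITE INDEX
("an open homomorphism", [AbsTopI] Def 4.2 (iii) p. 49). [cite: MochizukiAbsTopI2012, Def 4.2 (iii) p.49] -/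
theorem finiteIndex_range_rig (L : E.ChainGroup) : (L.rig.toMonoidHom.range).FiniteIndex :=
  finiteIndex_of_isOpen_of_compact _ (by rw [MonoidHom.coe_range]; exact L.isOpen_range_rig)

/-! ### "`1 → Δⱼ → Πⱼ → Gⱼ → 1` is an extension" -/

/-- `Δⱼ = Ker(Πⱼ → G)` is a CLOSED subgroup of `Πⱼ` (kernel of a continuous homomorphism to a
Hausdorff group). [cite: MochizukiAbsTopI2012, Rmk 4.2.2 p.51] -/
theorem isClosed_geomJ (L : E.ChainGroup) : IsClosed (L.geomJ : Set L.grp) := by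
  have h : (L.geomJ : Set L.grp) = L.proj ⁻¹' {1} := by
    ext x
    rfl
  rw [h]
  exact isClosed_singleton.preimage (map_continuous L.proj)

/-- `Δⱼ` is NORMAL in `Πⱼ`. [cite: MochizukiAbsTopI2012, Rmk 4.2.2 p.51] -/
theorem normal_geomJ (L : E.ChainGroup) : L.geomJ.Normal :=
  inferInstanceAs L.proj.toMonoidHom.ker.Normal

/-- Exactness on the right: `Πⱼ → G` co-restricts to a SURJECTION onto `Gⱼ`, with kernel `Δⱼ`; so
`1 → Δⱼ → Πⱼ → Gⱼ → 1` is an extension of profinite groups and `Πⱼ/Δⱼ ≅ Gⱼ` as abstract groups.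
[cite: MochizukiAbsTopI2012, Rmk 4.2.2 p.51] -/
theorem rangeRestrict_proj_surjective (L : E.ChainGroup) :
    Function.Surjective L.proj.toMonoidHom.rangeRestrict :=
  L.proj.toMonoidHom.rangeRestrict_surjective

/-- The kernel of the co-restricted projection `Πⱼ ↠ Gⱼ` is `Δⱼ`.
[cite: MochizukiAbsTopI2012, Rmk 4.2.2 p.51] -/
theorem ker_rangeRestrict_proj (L : E.ChainGroup) :
    L.proj.toMonoidHom.rangeRestrict.ker = L.geomJ :=
  L.proj.toMonoidHom.ker_rangeRestrict

/-- `Πⱼ/Δⱼ ≃ Gⱼ` as abstract groups (first isomorphism theorem; `Δⱼ = L.geomJ` is by definition the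
kernel `L.proj.toMonoidHom.ker`, spelled as the kernel here so that the quotient's group structure is
found by instance search). [cite: MochizukiAbsTopI2012, Rmk 4.2.2 p.51] -/
theorem nonempty_quotient_geomJ_mulEquiv_rangeProj (L : E.ChainGroup) :
    Nonempty (L.grp ⧸ L.proj.toMonoidHom.ker ≃* L.proj.toMonoidHom.range) :=
  ⟨QuotientGroup.quotientKerEquivRange L.proj.toMonoidHom⟩

/-- **[AbsTopI] Rmk 4.2.2, group side, assembled** (for `G` slim): every term `Πⱼ` is an extension
`1 → Δⱼ → Πⱼ → Gⱼ → 1` of the slim, finite-index open subgroup `Gⱼ ⊆ G` by the slim, non-trivial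
(structure fields `slim_ker`, `ker_ne_bot` = (2_Π)), closed, normal subgroup `Δⱼ`, with `Πⱼ ↠ Gⱼ`
surjective of kernel `Δⱼ` — "similar data to the data introduced at the beginning of Definition 4.2".
[cite: MochizukiAbsTopI2012, Rmk 4.2.2 p.51] -/
theorem remark_4_2_2_groupSide (hG : IsSlimGroup E.gal) (L : E.ChainGroup) :
    IsSlimGroup L.proj.toMonoidHom.range ∧ (L.proj.toMonoidHom.range).FiniteIndex ∧
      IsSlimGroup L.geomJ ∧ L.geomJ ≠ ⊥ ∧ IsClosed (L.geomJ : Set L.grp) ∧ L.geomJ.Normal ∧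
      Function.Surjective L.proj.toMonoidHom.rangeRestrict ∧
      L.proj.toMonoidHom.rangeRestrict.ker = L.geomJ :=
  ⟨L.isSlimGroup_rangeProj hG, L.finiteIndex_rangeProj, L.slim_ker, L.ker_ne_bot, L.isClosed_geomJ,
    L.normal_geomJ, L.rangeRestrict_proj_surjective, L.ker_rangeRestrict_proj⟩

end ChainGroup

end FundamentalExtension

end Literature.AnabelianGeometry.AbsoluteAnabelian

end
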